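import Mathlib
import HarnessLib
import HarnessLib.Audit
import Summits.AtomisticToContinuum.Statement
import Literature.MathematicalPhysics.QuantumManyBody.PeriodicBoseGas
import Literature.MathematicalPhysics.QuantumManyBody.PeriodicBoseGasImpurity
import HarnessLib.Audit.Status.Attr

/-!
Route: BECProbeMassFlow

# Route BECProbeMassFlow — heavy probe, then a boson — torus BEC from an atom at zero cloud momentum
plus an ε-recoil bridge

It suffices to show X = CloudMomentumAtom ∧ RecoilTransfer on the torus of side L = ((N+1)/ρ)^{1/3}
(card static-impurity-mass-flow,
conforming re-open of retired route BECImpurityMassFlow with both defects fixed: the deciding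
theorem now concludes the sub-problem decl
`BoseEinsteinCondensation`, and the bridge is quantified ∀δ₁ → ∃δ₂ so that it is neither vacuous nor
unusable by the glue). Deform the MASS of
one tagged particle coupled to the N others by the same v. At M = m the absolute ground state is the
Bose one (Perron–Frobenius) and the
tagged particle's zero-mode occupation IS n₀/(N+1); at M = ∞ the ground states are L^{-3/2}χ^{x}(X)
with χ^{x} the bath ground state around a
scatterer PINNED at x, and the tagged zero-mode occupation at M = ∞⁺ equals w₀(χ) = ‖Π_{P=0}χ‖² =
L⁻³∫⟨χ, T_t χ⟩dt, the weight of the atom at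
zero of the law of the dressing cloud's TOTAL MOMENTUM (= the box average of Anderson's overlaps
⟨χ^x,χ^y⟩). CloudMomentumAtom (S1): for
δ-near-minimisers Φ of the pinned-scatterer energy, w₀(Φ) = L⁻⁶∫_{cell^N}|∫_{cell}Φ(X+t𝟙)dt|²dX ≥ 1
− ε at small density, eventually in N.
RecoilTransfer (S2): whatever floor c the static weights have at slack δ₁, there is δ₂ such that
δ₂-near-minimisers Ω of the (N+1)-boson
periodic energy on the same torus have ⟨Ω,n₀Ω⟩ ≥ (c − ε)(N+1): recoil costs at most ε. The glue
StaticFloorCondenses (support) turns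
S1 ∧ S2 into constant-mode condensation ≥ N/2 (the PeriodicBEC body of stmt-0826), and the shared
crux BoundaryTransferWeak (stmt-0827)
yields the Dirichlet, mode-free conjunct.
Lean: `CloudMomentumAtom ∧ RecoilTransfer ∧ BoundaryTransferWeak`

## Assembly
Pure logic (rc 0 in Sketch.lean; axioms propext / Classical.choice / Quot.sound): fix v repulsive
finite-range; CloudMomentumAtom and
RecoilTransfer give their bodies for v; StaticFloorCondenses turns them into the PeriodicBEC body
for v; BoundaryTransferWeak gives
∃ρ₀ ∀ρ<ρ₀ HasGroundStateBEC v ρ, i.e. the sub-problem Statement decl `BoseEinsteinCondensation`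
(abbrev of the Literature conjecture).
Deciding theorem (glue.lean): `theorem closes (h1 : CloudMomentumAtom) (h2 : RecoilTransfer) (h3 :
StaticFloorCondenses)
(h4 : BoundaryTransferWeak) : BoseEinsteinCondensation := fun v hv => h4 v hv (h3 v hv (h1 v hv) (h2
v hv))`.

Rationale: WHY THIS LINE. The dial is the PROBE MASS, an axis no open route uses: at M = ∞ the many-body
question collapses to ONE variational problem of the bath
(N bosons plus a relocatable one-body tilt v^per(· − x), typed with the landed
`impurityPeriodicEnergy`), and translation invariance of the
torus turns "off-diagonal long-range order of the frozen probe" into the exact statement "the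
dressed bath keeps an atom at total momentum
zero" — the home ground of orthogonality-catastrophe technology (Anderson1967; rigorous fermionic
theory GebertKuttlerMuller2014,
GebertEtAl2016; Bose-polaron physics AstrakharchikPitaevskii2004, ShchadilovaEtAl2016,
GuentherEtAl2021, whose eq. (3) is the bosonic
catastrophe Z₀ ≈ exp(−αN^{1/3}(k_n b)²) of the IDEAL bath and whose eq. (14) log Z = −√2π nξb² is
the finite static residue once the bath
heals at ξ = (8πna)^{-1/2}; rigorous Bose polarons so far only in mean-field / Bogoliubov–Fröhlich
scalings, MysliwySeiringer2020,
LampartTriay2025). The return to M = m is filed as an ε-CLOSENESS between two neighbouring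
variational problems on one torus, not as a
monotonicity: the 1-D exact results (Castella1996, RoschKopp1995, Mcguire1965) forbid a comparison
principle in the mass, and at one loop
in 3-D the static deficit (√π/2)(b/a)²√(ρa³) and the depletion 1.505√(ρa³) are of the same order
with a v-dependent sign of the difference
(Numbers), so only smallness of both can be true uniformly. Imported area: impurity /
open-quantum-system physics (fidelity of ground
states under a local tilt, fidelity susceptibility = second negative moment of the density spectral
function, super-ohmic vs ohmic
baths) with the explicit dictionary tagged boson ↦ probe of mass M, n₀/N ↦ box-averaged tagged
affinity, ODLRO at M = ∞ ↦ atom at zero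
cloud momentum. What it does that other lines do not: the open routes (BECInfraredBound, BECIroning,
BECPhononFloor,
BECSectorPoincareTwoScale, BECCutLineWeakDisorder, …) bound occupations or landscapes of the
SYMMETRIC state head-on; here half of the
difficulty (S1) is a statement with no permutation symmetry of the probe and no condensate in its
formulation, killable by a single
static-impurity computation, and the other half (S2) compares neighbouring Hamiltonians; the retired
siblings BECRecoilCorrector /
BECParticleInduction keep recoil throughout (their cards call the static end "the hard envelope"),
so this is the complementary bet.

RANKED CRUXES. #2 CloudMomentumAtom (crux) — (card S1, M = ∞ endpoint) CLOUD MOMENTUM HAS AN ATOM AT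
ZERO, asymptotically full: for every repulsive finite-range v and ε > 0 there is ρ₀ > 0 such that
for 0 < ρ < ρ₀ and all large N there is δ > 0 with: every periodic N-boson trial state Φ on the
torus of side L = ((N+1)/ρ)^{1/3} whose pinned-scatterer energy impurityPeriodicEnergy v 0 Φ
(scatterer at the origin — WLOG by impurityPeriodicGroundStateEnergy_eq_of_position and translation
covariance) is within δ of its infimum has zero-TOTAL-momentum weight w₀(Φ) := L⁻⁶ ∫_{cell^N}
|∫_{cell} Φ(X + t𝟙) dt|² dX ≥ 1 − ε (Π_{P=0}Φ = L⁻³∫T_tΦ dt, so w₀ = ‖Π_{P=0}Φ‖² ∈ [0,1]). For the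
true ground state χ, w₀(χ) = L⁻³∫⟨χ,T_tχ⟩dt ≥ |⟨Φ_free,χ⟩|² (Anderson fidelity with the
scatterer-free ground state, which has P = 0), so the foreseen proof object is the fidelity of
ground states of H_N and H_N + Σ_j v^per(x_j); one loop: 1 − w₀ ≍ (b/a)²√(ρa³), finite in d = 3 only
because S(k) ≲ k/2c. v ≡ 0: no scatterer, w₀ = 1 for the constant ground state — true. [difficulty:
XL] (why it might fail: Uniform-in-N needs the bath to heal at scale ξ: the ideal gas has log Z₀ ≍
−N^{1/3}(k_n b)² (GuentherEtAl2021 eq. 3) and the one-loop exponent ρ∫|v̂|²S/ω² is finite only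
through S(k)≲k/c, ω(k)≳ck down to k~1/L — infrared-bound strength, possibly BEC-hard; log-divergent
in d=1.) [GuentherEtAl2021, Anderson1967, GebertKuttlerMuller2014, GebertEtAl2016,
AstrakharchikPitaevskii2004, MysliwySeiringer2020, LSSY2005]
#3 RecoilTransfer (crux) — (card S2, endpoint form "recoil costs at most ε") for every repulsive
finite-range v and ε > 0 there is ρ₀ > 0 such that for 0 < ρ < ρ₀ and all large N, for every real c
and every δ₁ > 0: IF every δ₁-near-minimiser Φ of the pinned-scatterer problem of CloudMomentumAtom
(N bosons, torus of side L = ((N+1)/ρ)^{1/3}) has w₀(Φ) ≥ c, THEN there is δ₂ > 0 such that every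
δ₂-near-minimiser Ω of the periodic (N+1)-boson energy on the same torus has constant-mode
occupation ⟨Ω, n₀Ω⟩ ≥ (c − ε)(N+1). Reading: n₀/(N+1) is the tagged particle's zero-mode occupation
at M = m (Perron–Frobenius), w₀ of the pinned ground state is the same occupation at M = ∞⁺
(Born–Oppenheimer on the flat torus: the heavy coordinate's effective potential is constant), so the
item says A^(m) ≥ A^(∞) − ε on the box average. Quantified ∀δ₁ → ∃δ₂ (the retired RecoilBridge chose
its δ first and was vacuous); c ≤ 0 and c > 1 are harmless (ofReal of a negative is 0; w₀ ≤ 1 and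
near-minimisers exist), v ≡ 0 true (both sides 1). [deps: CloudMomentumAtom] [difficulty: XL] (why
it might fail: No comparison principle: at one loop the static deficit ≈0.9(b/a)²√(ρa³)
(GuentherEtAl2021 eq.14) is BELOW the depletion 1.505√(ρa³) for hard spheres, so ε is load-bearing
and both deficits must vanish as ρ→0 uniformly in N — incomplete dilute BEC or an O(1) recoil cost
at scales ≫ξ kills it.) [Castella1996, RoschKopp1995, Mcguire1965, GuentherEtAl2021,
arXiv:1610.02203, LSSY2005, BoccatoEtAl2017, Fournais2020, LampartTriay2025]
#4 BoundaryTransferWeak (crux) — the shared mode-free boundary-condition transfer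
(stmt-AtomisticToContinuum-0827, verbatim; also wanted by BECIroning, BECPhononFloor and siblings):
for each repulsive finite-range v, the PeriodicBEC body for v (constant-mode condensation ≥ cN of
δ-near-minimisers on the torus of side (N/ρ)^{1/3}, all small ρ, all large N) implies ∃ρ₀ > 0 ∀ρ ∈
(0,ρ₀) HasGroundStateBEC v ρ (Dirichlet ground state, λ_max(γ) ≥ cN via condensateNumber). Expected
route: Neumann bracketing of interior sub-boxes (−Δ_Dir ≥ ⊕−Δ_Neu, v ≥ 0) + the mode-free criterion
λ_max ≥ tr γ²/N; only the ENERGY analogue is in print (LSSY2005 Ch. 2 after (2.8)). v ≡ 0: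
hypothesis and conclusion both true. [difficulty: L] (why it might fail: PeriodicBEC(v) is
ground-state-only (δ after N) at box (N/ρ)^{1/3}; the Dirichlet GS lies a wall term ≫δ above E₀^per
and interior restrictions are neither periodic nor of sharp N, so the hypothesis may never fire; BEC
is BC-sensitive (Robinson1976). Shared item stmt-0827.) [LSSY2005, Basti2022, BoccatoSeiringer2023,
Junge2026, Robinson1976, LauwersVerbeureZagrebnov2003]
#9 StaticFloorCondenses (support) — GLUE, per potential (logic + ENNReal/filter bookkeeping): for
each repulsive finite-range v, [CloudMomentumAtom body for v] → [RecoilTransfer body for v] →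
[PeriodicBEC body for v with c = 1/2] (the stmt-0826 shape = the hypothesis of
BoundaryTransferWeak). Proof: take ε = 1/4 in both bodies, ρ₀ = min(ρ₀¹, ρ₀²); for ρ < ρ₀ intersect
the two eventual-N sets; at such N the δ₁ of S1 gives the floor hypothesis of S2 with c = 1 − 1/4
(syntactically the same ofReal((1 − 1/4)·L⁶) term), whence δ₂ with ofReal((3/4 − 1/4)·(N+1)) ≤
condensateOccupation (N+1) L Ω.ψ for all δ₂-near-minimisers Ω; rewrite 3/4 − 1/4 = 1/2 and shift the
index N ↦ N+1 inside ∀ᶠ (Filter.eventually_atTop: M ≥ N₀+1 ⇒ M = (M−1)+1) to land on the PeriodicBEC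
body with c = 1/2. [difficulty: provable-now] [LSSY2005, Fournais2020]

TWO-LAYER PLAN. Foreseen glued splits (k ≤ 3, depth 1; nothing filed now). CloudMomentumAtom ⇐
AndersonFidelity → ProjectionGlue → CloudMomentumAtom,
where AndersonFidelity(v): δ-near-minimisers Ψ of the scatterer-free periodic energy and Φ of the
pinned one have |⟨Ψ,Φ⟩|² ≥ 1 − ε, and
ProjectionGlue: w₀(Φ) ≥ (|⟨Ψ,Φ⟩| − (1 − w₀(Ψ))^{1/2})² with w₀(Ψ) → 1 for free near-minimisers
(Π_{P=0} is an orthogonal projection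
commuting with H_N). If S1 resists unconditionally: CloudMomentumAtom ⇐ PhononLowerBound →
FidelitySusceptibilityBound → CloudMomentumAtom
(flow in the coupling s ∈ [0,1]; χ_F(s) = Σ_n |⟨n|V_imp|0_s⟩|²/(E_n − E₀)² ≤ ρ∫|v̂|² m₋₂(k), m₋₂ ≤
m₋₁/ω_min with the compressibility sum
rule), which would make the route CONDITIONAL on a Landau-type bound ω_min(k) ≥ c|k| — to be
declared with --conditional-on, never
smuggled. RecoilTransfer ⇐ TaggedEndpointIdentity → MassFlowComparison → RecoilTransfer once a
two-species layer exists (Definition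
requests): TaggedEndpointIdentity = at fixed (N, L) the κ → 0⁺ ground states of H_κ = −κΔ₀ + H_N +
Σ_j v^per(x_j − x₀) have tagged
zero-mode occupation → w₀(χ) (Born–Oppenheimer on the flat torus, provable with fixed-N spectral
theory); MassFlowComparison = the
tagged zero-mode occupation at κ = 1 is ≥ its κ = 0⁺ value − ε at small density (Feynman–Kac: a
Brownian tagged world-line of
diffusivity κ against a rigid one with a jump at imaginary time 0; or a bound on the κ-derivative
through the tagged kinetic energy
and the static density response).

KILL CRITERIA. ¬CloudMomentumAtom — a static bosonic orthogonality catastrophe in the dilute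
INTERACTING 3-D gas (w₀ of pinned-scatterer near-minimisers
→ 0 along N at arbitrarily small ρ, e.g. ≤ exp(−cL) as for the ideal bath) removes the M = ∞ anchor:
close `refuted:CloudMomentumAtom`
(the conjunct survives, the line does not; keep the typed w₀-floor as negative knowledge for every
impurity card). ¬RecoilTransfer with
CloudMomentumAtom standing means incomplete condensation in the dilute limit on the torus or an O(1)
recoil cost: close
`refuted:RecoilTransfer` and hand the witness to the negatives index (it bears on every torus route
through stmt-0826). ¬BoundaryTransferWeak:
shared fate with BECIroning / BECPhononFloor / BECSectorPoincareTwoScale — pivot to a Dirichlet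
rerun of S1/S2 closed by the PROVED
AtomisticToContinuum.BECInfraredBound.bec_of_zeroMode, not a close. The PeriodicBEC body proved by
any other route moots both cruxes
(close `superseded`); a refuter showing RecoilTransfer ⇔ the PeriodicBEC body outright (S1
provable-now and trivialising) demotes the
route to a restatement — then retire.

NOT DECOMPOSED YET. Fixed-(N, L) stability used silently by both cruxes: finiteness of the pinned
infimum at low density including hard cores (the old
ImpurityEnergyFinite: N disjoint bumps avoiding the scatterer;
impurityPeriodicGroundStateEnergy_ne_top covers bounded v), compact
resolvent, Perron–Frobenius uniqueness of the pinned ground state (hard-core connectivity caveat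
shared with every near-minimiser route),
δ below the gap ⇒ near-minimisers are e^{iθ}χ + small and w₀ is L²-Lipschitz; the Anderson-fidelity
strengthening and the sum-rule /
fidelity-susceptibility path (m₋₂ bounds, any Landau input); the two-species (tagged, mass-deformed)
layer and the Born–Oppenheimer
endpoint identity; the impurity scattering length b (of v at reduced mass m) versus a (of v at
reduced mass m/2) bookkeeping; the
N ↦ N+1 box convention (absorbed in the glue). All are layer-2 children or prover-side lemmas
(--supports).

CHEAPEST FALSIFIER. By hand at filing (done): with Bogoliubov S(k) = ε_k/ω_k the static exponent
n∫d³k(2π)⁻³|v̂_k|²ε_k/ω_k³ is IR- and UV-finite in d = 3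
and → 0 like (b/a)²√(ρa³) (GuentherEtAl2021 eq. (14)) — S1 passes at one loop; with equal-mass
recoil the same Bogoliubov–Fröhlich
integral is exactly 1/3 of it, but the TRUE equal-mass deficit is the depletion 1.505√(ρa³), above
the static deficit for hard spheres
and below it for Born-soft v: the ε-free ordering is v-dependent, the ε-form passes with room as ρ →
0 (Numbers) — recorded, not a kill.
Decisive cheap kill, numerical: PIGS/DMC for hard spheres at ρa³ ∈ [10⁻⁴, 10⁻²] with ONE pinned
sphere on the torus, estimator
w₀ = ⟨overlap ratio χ(X + t𝟙)/χ(X) averaged over rigid translations t⟩, N = 64 … 512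
(static-impurity DMC exists: arXiv:1610.02203 at
m_B/m_I = 0; arXiv:2105.07738): saturation near 1 − O(√(ρa³)) keeps S1, decay in N kills it. Lookup
(done): no rigorous
(no-)catastrophe theorem for a static impurity in an interacting Bose gas; rigorous OC is fermionic
(GebertKuttlerMuller2014,
GebertEtAl2016), rigorous Bose polarons are mean-field / Bogoliubov–Fröhlich (MysliwySeiringer2020,
LampartTriay2025).

NUMBERS. Bogoliubov depletion 1 − n₀/N = (8/3√π)√(ρa³) ≈ 1.505√(ρa³) (LSSY2005 App. A). Static
residue of the interacting bath: log Z =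
−√2π n₀ ξ b² with ξ = (8πn₀a)^{-1/2} (GuentherEtAl2021 eqs. (8), (14); their a ↦ our b = probe–boson
scattering length at reduced mass
m, their a_B ↦ our a), i.e. 1 − Z ≈ (√π/2)(b/a)²√(ρa³) ≈ 0.886(b/a)²√(ρa³); b/a ∈ [1, 2] between
hard spheres (b = a) and Born-soft
potentials (b = v̂(0)/4π = 2a), so the static deficit is 0.89…3.5 × √(ρa³) against the depletion
1.505√(ρa³): crossover at b/a ≈
1.30 — the ordering "recoil only helps" is NOT uniform in v at one loop; S2's ε absorbs either sign.
Ideal bath (v_bath = 0, probe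
coupling ≠ 0; excluded here because the SAME v couples everything): Z₀ = [1 − α(k_n
b)²/(2N^{2/3})]^{2N} ≈ exp(−αN^{1/3}(k_n b)²), α =
(π²/3 + 1/4)/(3π³)^{2/3} (GuentherEtAl2021 eq. (3)) — the catastrophe S1 must beat using repulsion.
Bogoliubov–Fröhlich one loop,
equal mass vs static at P_tot = 0: ∫₀^∞ q dq/(√(q²+2)(√(q²+2)+q)²) ÷ ∫₀^∞ q(q²+2)^{-3/2}dq =
(1/3√2)/(1/√2) = 1/3 (by hand). 1-D
calibration: OC exponent non-monotone in the probe mass, endpoint-ordered (Castella1996;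
RoschKopp1995), log-divergent static exponent
(no BEC in d = 1, as PitaevskiiStringariOneDimension demands). Items at open: 5 (3 cruxes of which 1
shared, 1 support, 1 assembly).

DEFINITION REQUESTS. None blocking: `impurityPeriodicEnergy` / `impurityPeriodicGroundStateEnergy`
(PeriodicBoseGasImpurity.lean) and the translation API
(PeriodicBoseGasImpurityTranslation.lean) landed for the retired sibling and are used verbatim; w₀
is inlined. After open (for the
foreseen split of RecoilTransfer): `ledger workitem add --kind definition --notion
taggedPeriodicEnergy --topic
Literature/MathematicalPhysics/QuantumManyBody` — periodic trial states of N bosons plus ONE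
distinguishable particle (symmetric in the
bosons only) with energy κ∫|∇₀Ψ|² + Σ_{j≥1}∫|∇_jΨ|² + Σ_j v^per(x_j − x₀)|Ψ|² + Σ_{i<j} v^per(x_i −
x_j)|Ψ|², κ ∈ [0,1], its infimum, and the
tagged zero-mode occupation; serves the impurity/polaron cards one-particle-at-a-time,
kv-insertion-corrector, frozen-bath-anderson-endpoint too.

Novelty: Searches (2026-08-15, this seat): `lit galaxy search "orthogonality catastrophe" --star all` (61
rows: X-ray-edge/Kondo/Luttinger books and papers; Sun–Rambow–Si arXiv:cond-mat/0404590 "OC in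
BECs", Lampart arXiv:1909.02430, a St Andrews OC thesis); `lit galaxy search "Bose polaron" --star
pdf` (18: Pascual–Boronat arXiv:2105.07738 QMC residue, Isaule et al. arXiv:2105.10801 RG, Lampart);
`lit galaxy search "infinitely heavy impurity" --star all` (2: Christianen thesis); `lit galaxy
search "static impurity in a Bose-Einstein condensate" --star pdf` (0); `lit search --source
crossref "Bose polaron mass imbalance QMC"` (10 → doi:10.1103/physreva.94.063640 = arXiv:1610.02203,
read: binding energies at m_B/m_I ∈ {0, 1, 2}, no residue-vs-mass data); `lit search --source
crossref "Anderson orthogonality catastrophe bosons ground state overlap impurity"` (15: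
Castella1996, doi:10.5488/cmp.20.13604; nothing rigorous); `lit vsearch "quasiparticle residue …
infinite mass … QMC"` (12 textbooks, e.g. book:pethick2008, book:griffin1993); `lit frontier
AtomisticToContinuum --since 2022` (30 rows: arXiv:2510.20493, arXiv:2603.20776 localisation lines,
no impurity work); `lit bridges AtomisticToContinuum --cross any` (none relevant); `lit read
arXiv:2004.07166` pp. 2–3 (eqs. (3), (8), (10), (14) quoted in Numbers) and arXiv:1610.02203 (note
3: mass-ratio perturbative energy); local hybrid index (searchd) unavailable 18:30–18:55Z (rc 75) —
the card's audits 5/15/29/32 had already swept zbMATH  [refs: 10.1103/physreva.94.063640, 10.5488/cmp.20.13604, cond-mat/0404590, 1909.02430, 2105.07738, 2105.10801, 1610.02203, 2510.20493, 2603.20776, 2004.07166, 1302.6124, doi:10.1103/physreva.94.063640, doi:10.5488/cmp.20.13604, book:pethick2008, book:griffin1993, Castella1996, GuentherEtAl2021, GebertKuttlerMuller2014, MysliwySeiringer2020, LampartTriay2025]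

Barriers (technique_class: impurity-mass-deformation, orthogonality-overlap): - technique_class: impurity-mass-deformation, orthogonality-overlap
- Literature.Barriers.AtomisticToContinuum.KineticGapLengthScales: evaded in the statements — no
energy-window × L² bookkeeping: S1/S2 are weight/occupation floors for near-minimisers with δ chosen
AFTER N (δ below the fixed-N gap is stability, not the mechanism); honest: an unconditional S1
through the fidelity susceptibility wants ω_min(k) ≥ c|k| (Landau), an input of infrared-bound
strength — if that is the only way the route declares itself conditional (Two-layer plan), it never
smuggles it.
- Literature.Barriers.AtomisticToContinuum.BogoliubovPerturbationInfrared: the static exponent is a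
one-loop functional of the DENSITY sector (∫|v̂|²S/ω²), gauge-invariant and IR-finite in d = 3 per
the entry's own scope note, no anomalous propagator; S2 is a non-perturbative closeness statement,
not a series; honest: beyond one loop an expansion around Bogoliubov meets the entry's divergences —
the bet is positivity (two POSITIVE ground states, overlaps = Bhattacharyya affinities of |Φ|²,
|χ|²) and Feynman–Kac instead.
- Literature.Barriers.AtomisticToContinuum.EnergyAsymptoticsWithoutCondensation: respected — no
energy asymptotics are matched; energies enter only as near-minimiser slack and inside fidelity
susceptibilities of a perturbed family (the entry's evasion (ii)); the 1-D Lieb–Liniger witness has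
a log-divergent static exponent, so S1 is false there as it must be.
- Literature.Barriers.AtomisticToContinuum.P

History (route lifecycle, newest last):
- 2026-08-25T01:49:37Z · DORMANT — reconciler: no traction for 7.3 d (last activity item-evidence-added at 2026-08-17T18:55:01Z); parked, not closed — `ledger route dormant route-AtomisticToConti (operator:999:626996)
- 2026-08-29T03:26:47Z · REACTIVATED — reconciler: reactivated — activity statement-checked at 2026-08-29T01:17:37Z after parking at 2026-08-25T01:49:37Z (operator:999:164081)

sub-problem: BoseEinsteinCondensation · status: open · opened planner-plancard-AtomisticToContinuum-BoseEin-9696e406-g2-0 2026-08-15T18:52:46Z · rev 0 · ledger route-AtomisticToContinuum-BECProbeMassFlow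
GENERATED by the gate from the ledger (D-0016/17). Provers cite these decls: `theorem foo : Summit.AtomisticToContinuum.BoseEinsteinCondensation.Theses.BECProbeMassFlow.<Decl> := …` in Summits/AtomisticToContinuum/BoseEinsteinCondensation/Theorems/<Name>.lean.
-/

namespace Summit.AtomisticToContinuum.BoseEinsteinCondensation.Theses.BECProbeMassFlow

open scoped BigOperators Topology Manifold Classical MeasureTheory ProbabilityTheory Matrix InnerProductSpace ComplexConjugate ContinuousMap
open Filter Set Function TopologicalSpace MeasureTheory

attribute [summit_statement] _root_.BoseEinsteinCondensation

/-- item stmt-AtomisticToContinuum-12310 · crux · rank 2 · open · by planner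
why it might fail: Uniform-in-N needs the bath to heal at scale ξ: the ideal gas has log Z₀ ≍ −N^{1/3}(k_n b)² (GuentherEtAl2021 eq. 3) and the one-loop exponent ρ∫|v̂|²S/ω² is finite only through S(k)≲k/c, ω(k)≳ck down to k~1/L — infrared-bound strength, possibly BEC-hard; log-divergent in d=1.
sources: GuentherEtAl2021, Anderson1967, GebertKuttlerMuller2014, GebertEtAl2016, AstrakharchikPitaevskii2004, MysliwySeiringer2020
[crux] (card S1, M = ∞ endpoint) CLOUD MOMENTUM HAS AN ATOM AT ZERO, asymptotically full: for every
repulsive finite-range v and ε > 0 there is ρ₀ > 0 such that for 0 < ρ < ρ₀ and all large N there is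
δ > 0 with: every periodic N-boson trial state Φ on the torus of side L = ((N+1)/ρ)^{1/3} whose
pinned-scatterer energy impurityPeriodicEnergy v 0 Φ (scatterer at the origin — WLOG by
impurityPeriodicGroundStateEnergy_eq_of_position and translation covariance) is within δ of its
infimum has zero-TOTAL-momentum weight w₀(Φ) := L⁻⁶ ∫_{cell^N} |∫_{cell} Φ(X + t𝟙) dt|² dX ≥ 1 − ε
(Π_{P=0}Φ = L⁻³∫T_tΦ dt, so w₀ = ‖Π_{P=0}Φ‖² ∈ [0,1]). For the true ground state χ, w₀(χ) =
L⁻³∫⟨χ,T_tχ⟩dt ≥ |⟨Φ_free,χ⟩|² (Anderson fidelity with the scatterer-free ground state, which has P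
= 0), so the foreseen proof object is the fidelity of ground states of H_N and H_N + Σ_j v^per(x_j);
one loop: 1 − w₀ ≍ (b/a)²√(ρa³), finite in d = 3 only because S(k) ≲ k/2c. v ≡ 0: no scatterer, w₀ =
1 for the constant ground state — true. [difficulty: XL] -/
@[route_item "route-AtomisticToContinuum-BECProbeMassFlow", crux]
def CloudMomentumAtom : Prop :=
  ∀ v : ℝ → ENNReal, Literature.MathematicalPhysics.QuantumManyBody.BoseGas.IsRepulsiveFiniteRange v → ∀ ε : ℝ, 0 < ε → ∃ ρ₀ : ℝ, 0 < ρ₀ ∧ ∀ ρ : ℝ, 0 < ρ → ρ < ρ₀ → ∀ᶠ N : ℕ in Filter.atTop, ∃ δ : ENNReal, 0 < δ ∧ ∀ Φ : Literature.MathematicalPhysics.QuantumManyBody.BoseGas.PeriodicTrialState N (Literature.MathematicalPhysics.QuantumManyBody.BoseGas.sideLength ρ (N + 1)), Literature.MathematicalPhysics.QuantumManyBody.BoseGas.impurityPeriodicEnergy v 0 Φ ≤ Literature.MathematicalPhysics.QuantumManyBody.BoseGas.impurityPeriodicGroundStateEnergy v N (Literature.MathematicalPhysics.QuantumManyBody.BoseGas.sideLength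 ρ (N + 1)) 0 + δ → ENNReal.ofReal ((1 - ε) * Literature.MathematicalPhysics.QuantumManyBody.BoseGas.sideLength ρ (N + 1) ^ 6) ≤ ∫⁻ X in Literature.MathematicalPhysics.QuantumManyBody.BoseGas.cellN N (Literature.MathematicalPhysics.QuantumManyBody.BoseGas.sideLength ρ (N + 1)), (‖∫ t in Literature.MathematicalPhysics.QuantumManyBody.BoseGas.cell (Literature.MathematicalPhysics.QuantumManyBody.BoseGas.sideLength ρ (N + 1)), Φ.ψ (X + fun _ => t)‖₊ : ENNReal) ^ 2

/-- item stmt-AtomisticToContinuum-12311 · crux · rank 3 · open · by planner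
why it might fail: No comparison principle: at one loop the static deficit ≈0.9(b/a)²√(ρa³) (GuentherEtAl2021 eq.14) is BELOW the depletion 1.505√(ρa³) for hard spheres, so ε is load-bearing and both deficits must vanish as ρ→0 uniformly in N — incomplete dilute BEC or an O(1) recoil cost at scales ≫ξ kills it.
sources: Castella1996, RoschKopp1995, Mcguire1965, GuentherEtAl2021, arXiv:1610.02203, LSSY2005
[crux] (card S2, endpoint form "recoil costs at most ε") for every repulsive finite-range v and ε >
0 there is ρ₀ > 0 such that for 0 < ρ < ρ₀ and all large N, for every real c and every δ₁ > 0: IF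
every δ₁-near-minimiser Φ of the pinned-scatterer problem of CloudMomentumAtom (N bosons, torus of
side L = ((N+1)/ρ)^{1/3}) has w₀(Φ) ≥ c, THEN there is δ₂ > 0 such that every δ₂-near-minimiser Ω of
the periodic (N+1)-boson energy on the same torus has constant-mode occupation ⟨Ω, n₀Ω⟩ ≥ (c −
ε)(N+1). Reading: n₀/(N+1) is the tagged particle's zero-mode occupation at M = m
(Perron–Frobenius), w₀ of the pinned ground state is the same occupation at M = ∞⁺ (Born–Oppenheimer
on the flat torus: the heavy coordinate's effective potential is constant), so the item says A^(m) ≥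
A^(∞) − ε on the box average. Quantified ∀δ₁ → ∃δ₂ (the retired RecoilBridge chose its δ first and
was vacuous); c ≤ 0 and c > 1 are harmless (ofReal of a negative is 0; w₀ ≤ 1 and near-minimisers
exist), v ≡ 0 true (both sides 1). [deps: CloudMomentumAtom] [difficulty: XL] -/
@[route_item "route-AtomisticToContinuum-BECProbeMassFlow", crux]
def RecoilTransfer : Prop :=
  ∀ v : ℝ → ENNReal, Literature.MathematicalPhysics.QuantumManyBody.BoseGas.IsRepulsiveFiniteRange v → ∀ ε : ℝ, 0 < ε → ∃ ρ₀ : ℝ, 0 < ρ₀ ∧ ∀ ρ : ℝ, 0 < ρ → ρ < ρ₀ → ∀ᶠ N : ℕ in Filter.atTop, ∀ c : ℝ, ∀ δ₁ : ENNReal, 0 < δ₁ → (∀ Φ : Literature.MathematicalPhysics.QuantumManyBody.BoseGas.PeriodicTrialState N (Literature.MathematicalPhysics.QuantumManyBody.BoseGas.sideLength ρ (N + 1)), Literature.MathematicalPhysics.QuantumManyBody.BoseGas.impurityPeriodicEnergy v 0 Φ ≤ Literature.MathematicalPhysics.QuantumManyBody.BoseGas.impurityPeriodicGroundStateEnergy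 v N (Literature.MathematicalPhysics.QuantumManyBody.BoseGas.sideLength ρ (N + 1)) 0 + δ₁ → ENNReal.ofReal (c * Literature.MathematicalPhysics.QuantumManyBody.BoseGas.sideLength ρ (N + 1) ^ 6) ≤ ∫⁻ X in Literature.MathematicalPhysics.QuantumManyBody.BoseGas.cellN N (Literature.MathematicalPhysics.QuantumManyBody.BoseGas.sideLength ρ (N + 1)), (‖∫ t in Literature.MathematicalPhysics.QuantumManyBody.BoseGas.cell (Literature.MathematicalPhysics.QuantumManyBody.BoseGas.sideLength ρ (N + 1)), Φ.ψ (X + fun _ => t)‖₊ : ENNReal) ^ 2) → ∃ δ₂ : ENNReal, 0 < δ₂ ∧ ∀ Ω : Literature.MathematicalPhysics.QuantumManyBody.BoseGas.PeriodicTrialState (N + 1) (Literature.MathematicalPhysics.QuantumManyBody.BoseGas.sideLength ρ (N + 1)), Literature.MathematicalPhysics.QuantumManyBody.BoseGas.periodicEnergy v Ω ≤ Literature.MathematicalPhysics.QuantumManyBody.BoseGas.periodicGroundStateEnergy v (N + 1) (Literature.MathematicalPhysics.QuantumManyBody.BoseGas.sideLength ρ (N + 1)) + δ₂ → ENNReal.ofReal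 ((c - ε) * ((N + 1 : ℕ) : ℝ)) ≤ Literature.MathematicalPhysics.QuantumManyBody.BoseGas.condensateOccupation (N + 1) (Literature.MathematicalPhysics.QuantumManyBody.BoseGas.sideLength ρ (N + 1)) Ω.ψ

/-- item stmt-AtomisticToContinuum-0827 · crux · rank 4 · open · by planner
why it might fail: PeriodicBEC(v) is ground-state-only (δ after N) at box (N/ρ)^{1/3}; the Dirichlet GS lies a wall term ≫δ above E₀^per and interior restrictions are neither periodic nor of sharp N, so the hypothesis may never fire; BEC is BC-sensitive (Robinson1976). Shared item stmt-0827.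
sources: LSSY2005, Basti2022, BoccatoSeiringer2023, Junge2026, Robinson1976, LauwersVerbeureZagrebnov2003
[crux] BoundaryTransferWeak (mode-free boundary-condition transfer, per potential): for each
repulsive finite-range v, PeriodicBEC(v) implies ∃ρ₀>0 ∀ρ∈(0,ρ₀) HasGroundStateBEC v ρ (Dirichlet
ground state, λ_max(γ) ≥ cN via condensateNumber). Not glue: near-minimiser slacks are O(N/L²) while
Dirichlet/periodic energies differ by a boundary term ≫ N/L², so no energy-comparison proof;
expected route: Neumann bracketing of interior sub-boxes (−Δ_Dir ≥ ⊕−Δ_Neu, v ≥ 0) + a mode-free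
criterion (λ_max ≥ tr γ²/N). Only the ENERGY analogue is in print (LiebSeiringerSolovejYngvason2005
Ch. 2 after (2.8)). v ≡ 0: hypothesis and conclusion both true. -/
@[route_item "route-AtomisticToContinuum-BECProbeMassFlow", crux]
def BoundaryTransferWeak : Prop :=
  ∀ v : ℝ → ENNReal, Literature.MathematicalPhysics.QuantumManyBody.BoseGas.IsRepulsiveFiniteRange v → (∃ ρ₀ : ℝ, 0 < ρ₀ ∧ ∀ ρ : ℝ, 0 < ρ → ρ < ρ₀ → ∃ c : ℝ, 0 < c ∧ ∀ᶠ N : ℕ in Filter.atTop, ∃ δ : ENNReal, 0 < δ ∧ ∀ Ψ : Literature.MathematicalPhysics.QuantumManyBody.BoseGas.PeriodicTrialState N (Literature.MathematicalPhysics.QuantumManyBody.BoseGas.sideLength ρ N), Literature.MathematicalPhysics.QuantumManyBody.BoseGas.periodicEnergy v Ψ ≤ Literature.MathematicalPhysics.QuantumManyBody.BoseGas.periodicGroundStateEnergy v N (Literature.MathematicalPhysics.QuantumManyBody.BoseGas.sideLength ρ N) + δ → ENNReal.ofReal (c * N) ≤ Literature.MathematicalPhysics.QuantumManyBody.BoseGas.condensateOccupation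 N (Literature.MathematicalPhysics.QuantumManyBody.BoseGas.sideLength ρ N) Ψ.ψ) → ∃ ρ₀ : ℝ, 0 < ρ₀ ∧ ∀ ρ : ℝ, 0 < ρ → ρ < ρ₀ → Literature.MathematicalPhysics.QuantumManyBody.BoseGas.HasGroundStateBEC v ρ

/-- item stmt-AtomisticToContinuum-12312 · support · rank 9 · closed · proved by Summit.AtomisticToContinuum.BoseEinsteinCondensation.Theorems.becProbeMassFlow_staticFloorCondenses_proof @ acdfbfd15783 (prover) · by planner
sources: LSSY2005, Fournais2020
[support] GLUE, per potential (logic + ENNReal/filter bookkeeping): for each repulsive finite-range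
v, [CloudMomentumAtom body for v] → [RecoilTransfer body for v] → [PeriodicBEC body for v with c =
1/2] (the stmt-0826 shape = the hypothesis of BoundaryTransferWeak). Proof: take ε = 1/4 in both
bodies, ρ₀ = min(ρ₀¹, ρ₀²); for ρ < ρ₀ intersect the two eventual-N sets; at such N the δ₁ of S1
gives the floor hypothesis of S2 with c = 1 − 1/4 (syntactically the same ofReal((1 − 1/4)·L⁶)
term), whence δ₂ with ofReal((3/4 − 1/4)·(N+1)) ≤ condensateOccupation (N+1) L Ω.ψ for all
δ₂-near-minimisers Ω; rewrite 3/4 − 1/4 = 1/2 and shift the index N ↦ N+1 inside ∀ᶠ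
(Filter.eventually_atTop: M ≥ N₀+1 ⇒ M = (M−1)+1) to land on the PeriodicBEC body with c = 1/2.
[difficulty: provable-now] -/
@[route_item "route-AtomisticToContinuum-BECProbeMassFlow", crux]
def StaticFloorCondenses : Prop :=
  ∀ v : ℝ → ENNReal, Literature.MathematicalPhysics.QuantumManyBody.BoseGas.IsRepulsiveFiniteRange v → (∀ ε : ℝ, 0 < ε → ∃ ρ₀ : ℝ, 0 < ρ₀ ∧ ∀ ρ : ℝ, 0 < ρ → ρ < ρ₀ → ∀ᶠ N : ℕ in Filter.atTop, ∃ δ : ENNReal, 0 < δ ∧ ∀ Φ : Literature.MathematicalPhysics.QuantumManyBody.BoseGas.PeriodicTrialState N (Literature.MathematicalPhysics.QuantumManyBody.BoseGas.sideLength ρ (N + 1)), Literature.MathematicalPhysics.QuantumManyBody.BoseGas.impurityPeriodicEnergy v 0 Φ ≤ Literature.MathematicalPhysics.QuantumManyBody.BoseGas.impurityPeriodicGroundStateEnergy v N (Literature.MathematicalPhysics.QuantumManyBody.BoseGas.sideLength ρ (N + 1)) 0 + δ → ENNReal.ofReal ((1 - ε) * Literature.MathematicalPhysics.QuantumManyBody.BoseGas.sideLength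 ρ (N + 1) ^ 6) ≤ ∫⁻ X in Literature.MathematicalPhysics.QuantumManyBody.BoseGas.cellN N (Literature.MathematicalPhysics.QuantumManyBody.BoseGas.sideLength ρ (N + 1)), (‖∫ t in Literature.MathematicalPhysics.QuantumManyBody.BoseGas.cell (Literature.MathematicalPhysics.QuantumManyBody.BoseGas.sideLength ρ (N + 1)), Φ.ψ (X + fun _ => t)‖₊ : ENNReal) ^ 2) → (∀ ε : ℝ, 0 < ε → ∃ ρ₀ : ℝ, 0 < ρ₀ ∧ ∀ ρ : ℝ, 0 < ρ → ρ < ρ₀ → ∀ᶠ N : ℕ in Filter.atTop, ∀ c : ℝ, ∀ δ₁ : ENNReal, 0 < δ₁ → (∀ Φ : Literature.MathematicalPhysics.QuantumManyBody.BoseGas.PeriodicTrialState N (Literature.MathematicalPhysics.QuantumManyBody.BoseGas.sideLength ρ (N + 1)), Literature.MathematicalPhysics.QuantumManyBody.BoseGas.impurityPeriodicEnergy v 0 Φ ≤ Literature.MathematicalPhysics.QuantumManyBody.BoseGas.impurityPeriodicGroundStateEnergy v N (Literature.MathematicalPhysics.QuantumManyBody.BoseGas.sideLength ρ (N + 1))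 0 + δ₁ → ENNReal.ofReal (c * Literature.MathematicalPhysics.QuantumManyBody.BoseGas.sideLength ρ (N + 1) ^ 6) ≤ ∫⁻ X in Literature.MathematicalPhysics.QuantumManyBody.BoseGas.cellN N (Literature.MathematicalPhysics.QuantumManyBody.BoseGas.sideLength ρ (N + 1)), (‖∫ t in Literature.MathematicalPhysics.QuantumManyBody.BoseGas.cell (Literature.MathematicalPhysics.QuantumManyBody.BoseGas.sideLength ρ (N + 1)), Φ.ψ (X + fun _ => t)‖₊ : ENNReal) ^ 2) → ∃ δ₂ : ENNReal, 0 < δ₂ ∧ ∀ Ω : Literature.MathematicalPhysics.QuantumManyBody.BoseGas.PeriodicTrialState (N + 1) (Literature.MathematicalPhysics.QuantumManyBody.BoseGas.sideLength ρ (N + 1)), Literature.MathematicalPhysics.QuantumManyBody.BoseGas.periodicEnergy v Ω ≤ Literature.MathematicalPhysics.QuantumManyBody.BoseGas.periodicGroundStateEnergy v (N + 1) (Literature.MathematicalPhysics.QuantumManyBody.BoseGas.sideLength ρ (N + 1)) + δ₂ → ENNReal.ofReal ((c - ε) * ((N + 1 : ℕ) : ℝ)) ≤ Literature.MathematicalPhysics.QuantumManyBody.BoseGas.condensateOccupation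 (N + 1) (Literature.MathematicalPhysics.QuantumManyBody.BoseGas.sideLength ρ (N + 1)) Ω.ψ) → ∃ ρ₀ : ℝ, 0 < ρ₀ ∧ ∀ ρ : ℝ, 0 < ρ → ρ < ρ₀ → ∃ c : ℝ, 0 < c ∧ ∀ᶠ N : ℕ in Filter.atTop, ∃ δ : ENNReal, 0 < δ ∧ ∀ Ψ : Literature.MathematicalPhysics.QuantumManyBody.BoseGas.PeriodicTrialState N (Literature.MathematicalPhysics.QuantumManyBody.BoseGas.sideLength ρ N), Literature.MathematicalPhysics.QuantumManyBody.BoseGas.periodicEnergy v Ψ ≤ Literature.MathematicalPhysics.QuantumManyBody.BoseGas.periodicGroundStateEnergy v N (Literature.MathematicalPhysics.QuantumManyBody.BoseGas.sideLength ρ N) + δ → ENNReal.ofReal (c * N) ≤ Literature.MathematicalPhysics.QuantumManyBody.BoseGas.condensateOccupation N (Literature.MathematicalPhysics.QuantumManyBody.BoseGas.sideLength ρ N) Ψ.ψ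

-- `StaticFloorCondenses` holds: proved by `Summit.AtomisticToContinuum.BoseEinsteinCondensation.Theorems.becProbeMassFlow_staticFloorCondenses_proof` @ acdfbfd15783 (its module imports this route file, so no `_holds` link can be stated here).

/-- item stmt-AtomisticToContinuum-12313 · assembly · rank 1 · closed · proved by Summit.AtomisticToContinuum.BoseEinsteinCondensation.Theorems.becProbeMassFlow_assembly_proof (prover) · by planner
sources: LSSY2005, PenroseOnsager1956
[assembly] CloudMomentumAtom → RecoilTransfer → StaticFloorCondenses → BoundaryTransferWeak →
BoseEinsteinCondensation (the conjunct). -/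
@[route_item "route-AtomisticToContinuum-BECProbeMassFlow"]
def Assembly : Prop :=
  CloudMomentumAtom → RecoilTransfer → StaticFloorCondenses → BoundaryTransferWeak → BoseEinsteinCondensation

-- `Assembly` holds: proved by `Summit.AtomisticToContinuum.BoseEinsteinCondensation.Theorems.becProbeMassFlow_assembly_proof` (its module imports this route file, so no `_holds` link can be stated here).

/-! D-0027 §2.1 — DECIDING THEOREM (planner-authored via `route open/edit --closes-file`; by planner-plancard-AtomisticToContinuum-BoseEin-9696e406-g2-0 2026-08-15T18:52:46Z):
its hypotheses are this route's items and its conclusion the sub-problem Statement (glue_lint), and it elaborates with this file. -/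

@[closes "route-AtomisticToContinuum-BECProbeMassFlow"] theorem closes (h1 : CloudMomentumAtom) (h2 : RecoilTransfer) (h3 : StaticFloorCondenses)
    (h4 : BoundaryTransferWeak) : BoseEinsteinCondensation :=
  fun v hv => h4 v hv (h3 v hv (h1 v hv) (h2 v hv))

end Summit.AtomisticToContinuum.BoseEinsteinCondensation.Theses.BECProbeMassFlow
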